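import Summits.QuantumFields.BalabanUV.T4Continuum.Support.FirstOrderModelRate
import Summits.QuantumFields.BalabanUV.T4Continuum.Support.RegularBackgroundTower
import Summits.QuantumFields.BalabanUV.T4Continuum.Spine.NE2ColourPerturbedLayerRate

/-!
# T⁴ programme, spine node NE2 (U1a), row B8 «general rate» PART 1, file 2 of 2 — THE COVARIANT-LAPLACIAN SUMMAND (rows B2 / B5) OF ROOT B
# WITH NODE NE3's INPUT ALLOWED AT ANY GEOMETRIC RATE `θ ∈ [L⁻¹, 1)` (STRUCTURE half of closer (M1′) of GAPS G-ne2leaf08g2-1, owner ruling R17 (c))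

NE2 formalisation swarm `b2b-balaban-t4-ne2-formalise-*`, leaf prover 07 (gen 3), HOLDER-LESS owner row B8 (CLAIMS.log 2026-08-20 owner ruling NE2
R17; INTENT of this seat the same day).  On top of file 1 `Support/FirstOrderModelRate` (tier A at rate `θ`), row B5's `Support/RegularBackgroundTower`
and the owner's ENGINE half `Spine/NE2ColourPerturbedLayerRate` (p216739).  APPEND-ONLY TWINS: no landed statement is edited; the instance of record
(rate `L⁻¹`: `RegularBackgroundTower.perturbationLaws_covariantLaplacian_of_regular` / `covariantLaplacian_rate_of_regular`) is neither touched nor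
superseded.
 * §2 (tier B, colour matrices) `LipschitzBackgroundMRate` / `BoundedBackgroundMRate` (two-spacing consistency `β·θ^k` in operator norm; the landed
   `ColourCovariantLaplacian.LipschitzBackgroundM` / `BoundedBackgroundM` are `θ = L⁻¹`), entry lemmas, **`perturbationLaws_colourCovariantLaplacian_rate`**
   (`κ = kappaCol`, `e₂ k = C2col·θ^k`; tier-A laws of file 1 per matrix unit, summed — row B2's proof verbatim);
 * §3 (row B5's read-outs at rate `θ`) **`lipschitzBackgroundMRate_of_regular`**, **`boundedBackgroundMRate_of_regular`** (the shifted-site term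
   `β / L^k` of the `z`-consistency majorised by `β·θ^k`), and node NE3's currency AT RATE `θ` by row B6's ALREADY GENERAL
   `NE2FromNE3.consistent_of_localRate` (`≤ card o·2C·θ^k`; no new NE3-side object): **`matrixBoundsRate_of_regular_of_localRate`**;
 * §4 the part-1 ENDs **`perturbationLaws_covariantLaplacian_of_regular_rate`** and **`covariantLaplacian_rate_of_regular_rate`**: row B5's
   `perturbationLaws_covariantLaplacian_of_regular` / `covariantLaplacian_rate_of_regular` with `hNE3 : LocalRate (bgReadings (regClass R)) C θ` for ANY
   `L⁻¹ ≤ θ < 1`, every other binder (`hreg`, `0 ≤ C`, `kappaCol … < 1`) unchanged, conclusion `TowerLimitRate … θ` through the owner's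
   `towerLimitRate_perturbed_king_kron_rate` BY NAME (at `θ = L⁻¹`, `hθ := le_rfl`, the first END is LITERALLY row B5's proposition — not
   re-declared, the instance of record is the special case).
Parts 2 (row B3's averaging summand), 3 (row B4's gauge slot) and 4 (the END `balaban_final_rate_of_regular_rate`) of row B8 are NOT in this file.

HONEST FRAMING (T4-DAG p. 1).  Bookkeeping twins at MODEL LEVEL on OUR typed towers (transporters `R` are DATA; no B0, c5); constants OURS; no new
estimate; nothing of node NE3 is proved (OPEN) — `hNE3` is DISPLAYED at rate `θ`; ROOT B CONDITIONAL exactly as before (c1/c2/c3/c7); NE2 (U1a) NOT proved;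
spine PROVED 0/9 unchanged; NOT infinite volume / mass gap / Clay.  HONEST DEPENDENCY: continuum YM on T⁴ ⇐ BetaPertH ∧ nine spine estimates (0/9
proved); BetaPertH ⇐ (D1) ∧ (D4) ∧ CAP+tail; G-an2-4 gates asym, D1 and NE2/3/4.  ABSOLUTE RULE kept (nothing internally minted enters as a cited
fact); hypothesis STRUCTURES on data only, no `def … : Prop` fact; no `sorry`.
-/

noncomputable section

open scoped BigOperators ComplexConjugate Matrix Matrix.Norms.L2Operator Kronecker
open Filter Topology

namespace Summit.QuantumFields.BalabanUV.T4Continuum.CovariantLaplacianRate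

open Literature.MathematicalPhysics.QuantumFieldTheory.Balaban1983to89.B5Prop11Plancherel
open Literature.MathematicalPhysics.QuantumFieldTheory.Balaban1983to89.B5G183RateUnitTower (lev lev_neZero)
open Literature.MathematicalPhysics.QuantumFieldTheory.Balaban1983to89.T4EtaRateMin (LocalRate)
open Summit.QuantumFields.BalabanUV.T4Continuum
open Summit.QuantumFields.BalabanUV.T4Continuum.CovariantAveragingTower (TowerLimitRate)
open Summit.QuantumFields.BalabanUV.T4Continuum.BalabanAveragedTowerUnit (idx Qlev calGlev one_le_lev' cast_lev')
open Summit.QuantumFields.BalabanUV.T4Continuum.BackgroundResolventTower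
open Summit.QuantumFields.BalabanUV.T4Continuum.KingPairingPlantedLaw
open Summit.QuantumFields.BalabanUV.T4Continuum.BlockPairingGeometry
open Summit.QuantumFields.BalabanUV.T4Continuum.NE2PerturbedLayer
open Summit.QuantumFields.BalabanUV.T4Continuum.FirstOrderBackgroundModel
open Summit.QuantumFields.BalabanUV.T4Continuum.FirstOrderAdjointModel
open Summit.QuantumFields.BalabanUV.T4Continuum.PerturbationAlgebra
open Summit.QuantumFields.BalabanUV.T4Continuum.ColourCovariantLaplacian
open Summit.QuantumFields.BalabanUV.T4Continuum.KroneckerUnits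
open Summit.QuantumFields.BalabanUV.T4Continuum.AbelianCovariantLaplacian (tauInv tauInv_tau tau_tauInv)
open Summit.QuantumFields.BalabanUV.T4Continuum.RegularBackgroundTower
open Summit.QuantumFields.BalabanUV.T4Continuum.NE2FromNE3 (bgReadings consistent_of_localRate)
open Summit.QuantumFields.BalabanUV.T4Continuum.NE2ColourPerturbedLayerRate (towerLimitRate_perturbed_king_kron_rate)
open Summit.QuantumFields.BalabanUV.T4Continuum.FirstOrderModelRate

variable {d : ℕ}

/-! ## §2 Tier B at rate `θ`: colour-matrix structures and the non-abelian covariant Laplacian -/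

section TierB

variable (L : ℕ) [NeZero L] (M : Fin d → ℕ) [hM : ∀ μ, NeZero (M μ)] (a : ℝ) (ha : 0 < a)
variable {o : Type*} [Fintype o] [DecidableEq o]

/-- MATRIX-LEVEL Lipschitz background, two-spacing consistent AT RATE `θ` in operator norm (`ColourCovariantLaplacian.LipschitzBackgroundM` is
`θ = L⁻¹`). [folklore] -/
structure LipschitzBackgroundMRate (W : (k : ℕ) → Fin d → (idx L M k → Matrix o o ℂ)) (α β θ : ℝ) : Prop where
  /-- `α, β ≥ 0` -/
  nonneg : 0 ≤ α ∧ 0 ≤ β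
  /-- size -/
  bound : ∀ k μ i, ‖W k μ i‖ ≤ α
  /-- Lipschitz at spacing `L^{−k}` -/
  lipschitz : ∀ k μ ν i, ‖W k μ (tau (fine (lev L k) M) ν i) - W k μ i‖ ≤ β / (lev L k : ℕ)
  /-- two-spacing consistency at the block parent, rate `θ` -/
  consistent : ∀ k μ (i : idx L M (k + 1)), ‖W (k + 1) μ i - W k μ (parT (lev L k) L M i)‖ ≤ β * θ ^ k

/-- MATRIX-LEVEL bounded zeroth-order field, two-spacing consistent AT RATE `θ` (`ColourCovariantLaplacian.BoundedBackgroundM` is `θ = L⁻¹`).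
[folklore] -/
structure BoundedBackgroundMRate (Z : (k : ℕ) → (idx L M k → Matrix o o ℂ)) (α β θ : ℝ) : Prop where
  /-- `α, β ≥ 0` -/
  nonneg : 0 ≤ α ∧ 0 ≤ β
  /-- size -/
  bound : ∀ k i, ‖Z k i‖ ≤ α
  /-- two-spacing consistency at the block parent, rate `θ` -/
  consistent : ∀ k (i : idx L M (k + 1)), ‖Z (k + 1) i - Z k (parT (lev L k) L M i)‖ ≤ β * θ ^ k

omit [NeZero L] hM in
/-- **THE INSTANCE OF RECORD IS THE SPECIAL CASE `θ = L⁻¹`**: `ColourCovariantLaplacian.LipschitzBackgroundM W α β` gives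
`LipschitzBackgroundMRate W α β L⁻¹` (`β / L^k = β·(L⁻¹)^k`). [folklore] -/
theorem lipschitzBackgroundMRate_of_lev {W : (k : ℕ) → Fin d → (idx L M k → Matrix o o ℂ)} {α β : ℝ}
    (h : LipschitzBackgroundM L M W α β) : LipschitzBackgroundMRate L M W α β ((L : ℝ)⁻¹) where
  nonneg := h.nonneg
  bound := h.bound
  lipschitz := h.lipschitz
  consistent := fun k μ i => by rw [← div_lev_eq_mul_invPow L β k]; exact h.consistent k μ i

omit [NeZero L] hM in
/-- and conversely: at `θ = L⁻¹` the rate structure IS the landed one. [folklore] -/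
theorem lipschitzBackgroundM_of_rate_lev {W : (k : ℕ) → Fin d → (idx L M k → Matrix o o ℂ)} {α β : ℝ}
    (h : LipschitzBackgroundMRate L M W α β ((L : ℝ)⁻¹)) : LipschitzBackgroundM L M W α β where
  nonneg := h.nonneg
  bound := h.bound
  lipschitz := h.lipschitz
  consistent := fun k μ i => by rw [div_lev_eq_mul_invPow L β k]; exact h.consistent k μ i

omit [NeZero L] hM in
/-- **THE INSTANCE OF RECORD IS THE SPECIAL CASE `θ = L⁻¹`**, zeroth order: `ColourCovariantLaplacian.BoundedBackgroundM Z α β` gives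
`BoundedBackgroundMRate Z α β L⁻¹`. [folklore] -/
theorem boundedBackgroundMRate_of_lev {Z : (k : ℕ) → (idx L M k → Matrix o o ℂ)} {α β : ℝ}
    (h : BoundedBackgroundM L M Z α β) : BoundedBackgroundMRate L M Z α β ((L : ℝ)⁻¹) where
  nonneg := h.nonneg
  bound := h.bound
  consistent := fun k i => by rw [← div_lev_eq_mul_invPow L β k]; exact h.consistent k i

omit [NeZero L] hM in
/-- and conversely, zeroth order. [folklore] -/
theorem boundedBackgroundM_of_rate_lev {Z : (k : ℕ) → (idx L M k → Matrix o o ℂ)} {α β : ℝ}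
    (h : BoundedBackgroundMRate L M Z α β ((L : ℝ)⁻¹)) : BoundedBackgroundM L M Z α β where
  nonneg := h.nonneg
  bound := h.bound
  consistent := fun k i => by rw [div_lev_eq_mul_invPow L β k]; exact h.consistent k i

omit [NeZero L] hM in
/-- entries inherit the matrix-level hypotheses (`|X a b| ≤ ‖X‖`). [folklore] -/
theorem lipschitzBackgroundRate_entry {W : (k : ℕ) → Fin d → (idx L M k → Matrix o o ℂ)} {α β θ : ℝ}
    (h : LipschitzBackgroundMRate L M W α β θ) (p : o × o) : LipschitzBackgroundRate L M (fun k ν i => W k ν i p.1 p.2) α β θ where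
  nonneg := h.nonneg
  bound := fun k μ i => (norm_entry_le _ p.1 p.2).trans (h.bound k μ i)
  lipschitz := fun k μ ν i => by
    rw [← Matrix.sub_apply]; exact (norm_entry_le _ p.1 p.2).trans (h.lipschitz k μ ν i)
  consistent := fun k μ i => by
    rw [← Matrix.sub_apply]; exact (norm_entry_le _ p.1 p.2).trans (h.consistent k μ i)

omit [NeZero L] hM in
/-- entries inherit the matrix-level hypotheses, zeroth order. [folklore] -/
theorem boundedBackgroundRate_entry {Z : (k : ℕ) → (idx L M k → Matrix o o ℂ)} {α β θ : ℝ} (h : BoundedBackgroundMRate L M Z α β θ)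
    (p : o × o) : BoundedBackgroundRate L M (fun k i => Z k i p.1 p.2) α β θ where
  nonneg := h.nonneg
  bound := fun k i => (norm_entry_le _ p.1 p.2).trans (h.bound k i)
  consistent := fun k i => by
    rw [← Matrix.sub_apply]; exact (norm_entry_le _ p.1 p.2).trans (h.consistent k i)

/-- **`PerturbationLaws` FOR THE NON-ABELIAN COVARIANT LAPLACIAN AT RATE `θ`** (`d ≥ 1`, `L⁻¹ ≤ θ`): from ENTRYWISE `LipschitzBackgroundRate` of
`−w` (`α, β`) and `BoundedBackgroundRate` of `z` (`α′, β′`), `κ = κ_col`, `e₂ k = C₂^col·θ^k` — row B2's proof (tier-A laws per matrix unit, summed)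
verbatim at rate `θ`. [folklore] -/
theorem perturbationLaws_colourCovariantLaplacian_rate (hd : 1 ≤ d) {R : (k : ℕ) → Fin d → (idx L M k → Matrix o o ℂ)}
    {α β α' β' θ : ℝ} (hθ : ((L : ℝ)⁻¹) ≤ θ) (hV : ∀ p : o × o, LipschitzBackgroundRate L M (Vab L M R p) α β θ)
    (hz : ∀ p : o × o, BoundedBackgroundRate L M (Zab L M R p) α' β' θ) :
    PerturbationLaws (fun k => calDalev L M a ha k ⊗ₖ (1 : Matrix o o ℂ)) (covPertC L M R)
      (fun k => JpcT L M k ⊗ₖ (1 : Matrix o o ℂ)) (kappaCol o d a α β α') (fun k => C2col o d L a α β β' * θ ^ k) := by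
  have hθ0 := rate_nonneg L hθ
  have hF : PerturbationLaws (fun k => calDalev L M a ha k ⊗ₖ (1 : Matrix o o ℂ)) (fun k => ∑ p : o × o, pieceF L M R p k)
      (fun k => JpcT L M k ⊗ₖ (1 : Matrix o o ℂ)) (∑ _p : o × o, d * (α + β) * Cst d a)
      (fun k => ∑ _p : o × o, C2model d L a α β * θ ^ k) :=
    perturbationLaws_finsetSum _ fun p _ =>
      perturbationLaws_kronUnit (perturbationLaws_firstOrder_rate L M a ha hd hθ (hV p)) p.1 p.2
  have hA : PerturbationLaws (fun k => calDalev L M a ha k ⊗ₖ (1 : Matrix o o ℂ)) (fun k => ∑ p : o × o, pieceA L M R p k)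
      (fun k => JpcT L M k ⊗ₖ (1 : Matrix o o ℂ)) (∑ _p : o × o, d * (α + β) * Cst d a)
      (fun k => ∑ _p : o × o, C2adj d L a α β * θ ^ k) :=
    perturbationLaws_finsetSum _ fun p _ =>
      perturbationLaws_kronUnit (perturbationLaws_firstOrderAdjoint_rate L M a ha hd hθ (hV p)) p.2 p.1
  have hZ : PerturbationLaws (fun k => calDalev L M a ha k ⊗ₖ (1 : Matrix o o ℂ)) (fun k => ∑ p : o × o, pieceZ L M R p k)
      (fun k => JpcT L M k ⊗ₖ (1 : Matrix o o ℂ)) (∑ _p : o × o, α' * Cst d a)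
      (fun k => ∑ _p : o × o, Cst d a * β' * Cst d a * θ ^ k) :=
    perturbationLaws_finsetSum _ fun p _ =>
      perturbationLaws_kronUnit (perturbationLaws_zerothOrder_rate L M a ha hθ0 (hz p)) p.1 p.2
  have h := perturbationLaws_add (perturbationLaws_add hF hA) hZ
  have e : covPertC L M R
      = fun k => (∑ p : o × o, pieceF L M R p k) + (∑ p : o × o, pieceA L M R p k) + ∑ p : o × o, pieceZ L M R p k :=
    funext fun k => covPertC_eq L M R k
  rw [e]
  refine perturbationLaws_mono h (le_of_eq ?_) fun k => le_of_eq ?_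
  · simp only [Finset.sum_const, Finset.card_univ, Fintype.card_prod, kappaCol]; ring
  · simp only [Finset.sum_const, Finset.card_univ, Fintype.card_prod, C2col]; ring

/-! ## §3 Row B5's read-outs at rate `θ`: the (3.35)-shape class + two-spacing consistencies `βc·θ^k`, `βD·θ^k` -/

variable {L M} {R : (k : ℕ) → Fin d → (idx L M k → Matrix o o ℂ)} {α β βc βD θ : ℝ}

omit [NeZero L] hM in
/-- **`−w` IS A `LipschitzBackgroundMRate α (max β βc) θ`** given row B5's structure and the two-spacing consistency of the connection tower AT RATE
`θ` (constant `βc` — node NE3's currency). [folklore] -/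
theorem lipschitzBackgroundMRate_of_regular (hreg : RegularTransporters L M R α β) (hθ0 : 0 ≤ θ)
    (hcons : ∀ k ν (i : idx L M (k + 1)), ‖connTower L M R (k + 1) ν i - connTower L M R k ν (parT (lev L k) L M i)‖ ≤ βc * θ ^ k) :
    LipschitzBackgroundMRate L M (fun k ν i => negConnM (fine (lev L k) M) ((lev L k : ℕ) : ℂ) (R k) ν i) α (max β βc) θ where
  nonneg := ⟨hreg.nonneg.1, le_max_of_le_left hreg.nonneg.2⟩
  bound := fun k μ i => by
    show ‖negConnM (fine (lev L k) M) ((lev L k : ℕ) : ℂ) (R k) μ i‖ ≤ α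
    rw [negConnM_eq_neg, norm_neg]; exact norm_connTower_le hreg k μ i
  lipschitz := fun k μ ν i => by
    show ‖negConnM (fine (lev L k) M) ((lev L k : ℕ) : ℂ) (R k) μ (tau (fine (lev L k) M) ν i)
        - negConnM (fine (lev L k) M) ((lev L k : ℕ) : ℂ) (R k) μ i‖ ≤ max β βc / (lev L k : ℕ)
    rw [negConnM_eq_neg, negConnM_eq_neg, neg_sub_neg, norm_sub_rev]
    exact (connTower_lipschitz hreg k μ ν i).trans (div_le_div_of_nonneg_right (le_max_left _ _) (Nat.cast_nonneg _))
  consistent := fun k μ i => by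
    show ‖negConnM (fine (lev L (k + 1)) M) ((lev L (k + 1) : ℕ) : ℂ) (R (k + 1)) μ i
        - negConnM (fine (lev L k) M) ((lev L k : ℕ) : ℂ) (R k) μ (parT (lev L k) L M i)‖ ≤ max β βc * θ ^ k
    rw [negConnM_eq_neg, negConnM_eq_neg, neg_sub_neg, norm_sub_rev]
    exact (hcons k μ i).trans (mul_le_mul_of_nonneg_right (le_max_right _ _) (pow_nonneg hθ0 k))

/-- consistency read at a backward-shifted site, rate form: `‖W′(τ⁻¹x′) − W(τ⁻¹(parT x′))‖ ≤ e + β/L^k` from a two-level bound `e` at this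
level pair and the lattice-Lipschitz bound `β/L^k` (row B5's shifted-site geometry `norm_sub_parT_tauInv_le`). [folklore] -/
theorem norm_tauInv_sub_tauInv_parT_le_of {W : (k : ℕ) → Fin d → (idx L M k → Matrix o o ℂ)} {β e : ℝ} (hβ : 0 ≤ β)
    (hlip : ∀ k μ ν (i : idx L M k), ‖W k μ (tau (fine (lev L k) M) ν i) - W k μ i‖ ≤ β / (lev L k : ℕ)) {k : ℕ}
    (hcons : ∀ μ (i : idx L M (k + 1)), ‖W (k + 1) μ i - W k μ (parT (lev L k) L M i)‖ ≤ e)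
    (μ ν : Fin d) (i : idx L M (k + 1)) :
    ‖W (k + 1) μ (tauInv (fine (lev L (k + 1)) M) ν i) - W k μ (tauInv (fine (lev L k) M) ν (parT (lev L k) L M i))‖
      ≤ e + β / (lev L k : ℕ) :=
  calc ‖W (k + 1) μ (tauInv (fine (lev L (k + 1)) M) ν i) - W k μ (tauInv (fine (lev L k) M) ν (parT (lev L k) L M i))‖
      ≤ ‖W (k + 1) μ (tauInv (fine (lev L (k + 1)) M) ν i) - W k μ (parT (lev L k) L M (tauInv (fine (lev L (k + 1)) M) ν i))‖
        + ‖W k μ (parT (lev L k) L M (tauInv (fine (lev L (k + 1)) M) ν i)) - W k μ (tauInv (fine (lev L k) M) ν (parT (lev L k) L M i))‖ :=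
        norm_sub_le_norm_sub_add_norm_sub _ _ _
    _ ≤ e + β / (lev L k : ℕ) := add_le_add (hcons μ _) (norm_sub_parT_tauInv_le hβ hlip k μ ν i)

/-- **`z` IS A `BoundedBackgroundMRate (d(α² + 2β)) (d(2α(βc + β) + 2βD)) θ`** given row B5's structure and the two-spacing consistencies AT RATE `θ`
of the connection tower (`βc`) and of its derivative tower (`βD`); the shifted-site term `β/L^k` is majorised by `β·θ^k` (`L⁻¹ ≤ θ`). [folklore] -/
theorem boundedBackgroundMRate_of_regular (hreg : RegularTransporters L M R α β) (hθ : ((L : ℝ)⁻¹) ≤ θ) (hβc : 0 ≤ βc) (hβD : 0 ≤ βD)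
    (hcons : ∀ k ν (i : idx L M (k + 1)), ‖connTower L M R (k + 1) ν i - connTower L M R k ν (parT (lev L k) L M i)‖ ≤ βc * θ ^ k)
    (hconsD : ∀ k ν (i : idx L M (k + 1)),
      ‖dconnTower L M R (k + 1) ν i - dconnTower L M R k ν (parT (lev L k) L M i)‖ ≤ βD * θ ^ k) :
    BoundedBackgroundMRate L M (fun k i => zfieldC (fine (lev L k) M) ((lev L k : ℕ) : ℂ) (R k) i)
      (d * (α ^ 2 + 2 * β)) (d * (2 * α * (βc + β) + 2 * βD)) θ where
  nonneg := by
    obtain ⟨hα, hβ⟩ := hreg.nonneg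
    exact ⟨by positivity, by positivity⟩
  bound := fun k i => norm_zTower_le hreg k i
  consistent := fun k i => by
    obtain ⟨hα, hβ⟩ := hreg.nonneg
    have hθ0 := rate_nonneg L hθ
    have hθk : 0 ≤ θ ^ k := pow_nonneg hθ0 k
    show ‖zTower L M R (k + 1) i - zTower L M R k (parT (lev L k) L M i)‖ ≤ d * (2 * α * (βc + β) + 2 * βD) * θ ^ k
    rw [zTower_eq, zTower_eq, ← Finset.sum_sub_distrib]
    set p := parT (lev L k) L M i with hp
    calc ‖∑ ν, ((connTower L M R (k + 1) ν (tauInv (fine (lev L (k + 1)) M) ν i))ᴴ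
              * connTower L M R (k + 1) ν (tauInv (fine (lev L (k + 1)) M) ν i)
            - dconnTower L M R (k + 1) ν i - (dconnTower L M R (k + 1) ν i)ᴴ
            - ((connTower L M R k ν (tauInv (fine (lev L k) M) ν p))ᴴ * connTower L M R k ν (tauInv (fine (lev L k) M) ν p)
              - dconnTower L M R k ν p - (dconnTower L M R k ν p)ᴴ))‖
        ≤ ∑ ν : Fin d, (2 * α * (βc + β) + 2 * βD) * θ ^ k := by
          refine norm_sum_le_of_le _ fun ν _ => ?_
          set X' := connTower L M R (k + 1) ν (tauInv (fine (lev L (k + 1)) M) ν i)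
          set X := connTower L M R k ν (tauInv (fine (lev L k) M) ν p)
          set D' := dconnTower L M R (k + 1) ν i
          set D := dconnTower L M R k ν p
          have hX' : ‖X'‖ ≤ α := norm_connTower_le hreg (k + 1) ν _
          have hX : ‖X‖ ≤ α := norm_connTower_le hreg k ν _
          have hXX : ‖X' - X‖ ≤ (βc + β) * θ ^ k :=
            calc ‖X' - X‖ ≤ βc * θ ^ k + β / (lev L k : ℕ) :=
                  norm_tauInv_sub_tauInv_parT_le_of hβ (fun k μ ν i => connTower_lipschitz hreg k μ ν i)
                    (fun μ i => hcons k μ i) ν ν i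
              _ ≤ βc * θ ^ k + β * θ ^ k := add_le_add le_rfl (div_lev_le_mul_pow L hβ hθ k)
              _ = (βc + β) * θ ^ k := by ring
          have hDD : ‖D' - D‖ ≤ βD * θ ^ k := hconsD k ν i
          have e : X'ᴴ * X' - D' - D'ᴴ - (Xᴴ * X - D - Dᴴ) = (X'ᴴ * X' - Xᴴ * X) - (D' - D) - (D' - D)ᴴ := by
            rw [Matrix.conjTranspose_sub]; abel
          rw [e]
          calc ‖(X'ᴴ * X' - Xᴴ * X) - (D' - D) - (D' - D)ᴴ‖
              ≤ ‖X'ᴴ * X' - Xᴴ * X‖ + ‖D' - D‖ + ‖(D' - D)ᴴ‖ :=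
                (norm_sub_le _ _).trans (add_le_add (norm_sub_le _ _) le_rfl)
            _ ≤ (α + α) * ((βc + β) * θ ^ k) + βD * θ ^ k + βD * θ ^ k := by
                rw [Matrix.l2_opNorm_conjTranspose]
                refine add_le_add (add_le_add ?_ hDD) hDD
                exact (norm_gram_sub_gram_le X' X).trans
                  (mul_le_mul (add_le_add hX' hX) hXX (norm_nonneg _) (by positivity))
            _ = (2 * α * (βc + β) + 2 * βD) * θ ^ k := by ring
      _ = d * (2 * α * (βc + β) + 2 * βD) * θ ^ k := by
          rw [Finset.sum_const, Finset.card_univ, Fintype.card_fin, nsmul_eq_mul]; ring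

/-- **NODE NE3's CURRENCY AT RATE `θ` ⇒ THE TWO MATRIX-LEVEL HYPOTHESES AT RATE `θ`**, from `hreg` and `hNE3 : LocalRate (bgReadings (regClass R)) C θ`
(the consistencies of `w` and `Dw` READ OFF `LocalRate` by row B6's GENERAL `NE2FromNE3.consistent_of_localRate`: `βc = βD = betaNE3 o C = 2·card o·C`,
majorant `βNE3·θ^k`). [folklore] -/
theorem matrixBoundsRate_of_regular_of_localRate (hreg : RegularTransporters L M R α β) {C : ℝ} (hC : 0 ≤ C) (hθ : ((L : ℝ)⁻¹) ≤ θ)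
    (hNE3 : LocalRate (bgReadings L M (regClass L M R)) C θ) :
    LipschitzBackgroundMRate L M (fun k ν i => negConnM (fine (lev L k) M) ((lev L k : ℕ) : ℂ) (R k) ν i) α (max β (betaNE3 o C)) θ ∧
    BoundedBackgroundMRate L M (fun k i => zfieldC (fine (lev L k) M) ((lev L k : ℕ) : ℂ) (R k) i)
      (d * (α ^ 2 + 2 * β)) (d * (2 * α * (betaNE3 o C + β) + 2 * betaNE3 o C)) θ := by
  have hθ0 := rate_nonneg L hθ
  have hb : 0 ≤ betaNE3 o C := by unfold betaNE3; positivity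
  have hw' := consistent_of_localRate L M hC hθ0 hNE3 (Set.mem_insert _ _ : connTower L M R ∈ regClass L M R)
  have hD' := consistent_of_localRate L M hC hθ0 hNE3
    (Set.mem_insert_of_mem _ (Set.mem_singleton _) : dconnTower L M R ∈ regClass L M R)
  have hw : ∀ k ν (i : idx L M (k + 1)),
      ‖connTower L M R (k + 1) ν i - connTower L M R k ν (parT (lev L k) L M i)‖ ≤ betaNE3 o C * θ ^ k := fun k ν i =>
    (hw' k ν i).trans (le_of_eq (by unfold betaNE3; ring))
  have hD : ∀ k ν (i : idx L M (k + 1)),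
      ‖dconnTower L M R (k + 1) ν i - dconnTower L M R k ν (parT (lev L k) L M i)‖ ≤ betaNE3 o C * θ ^ k := fun k ν i =>
    (hD' k ν i).trans (le_of_eq (by unfold betaNE3; ring))
  exact ⟨lipschitzBackgroundMRate_of_regular hreg hθ0 hw, boundedBackgroundMRate_of_regular hreg hθ hb hb hw hD⟩

/-! ## §4 The part-1 ENDs: the covariant-Laplacian summand of ROOT B with `hNE3` at any rate `θ ∈ [L⁻¹, 1)` -/

variable (L M)

/-- **THE TYPED RESIDUAL FOR THE COVARIANT-LAPLACIAN SUMMAND, FROM THE REGULARITY CLASS AND NODE NE3 AT RATE `θ`** (`d ≥ 1`, `L⁻¹ ≤ θ`):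
`PerturbationLaws (Δ_a ⊗ 1) (k ↦ Δ^{R_k} − Δ^1 ⊗ 1) (J ⊗ 1) κ (k ↦ C₂·θ^k)` with the SAME `κ = kappaCol o d a α (max β βNE3) (d(α² + 2β))` and
`C₂ = C2col o d L a α (max β βNE3) (d(2α(βNE3 + β) + 2βNE3))` as `RegularBackgroundTower.perturbationLaws_covariantLaplacian_of_regular` (its `θ = L⁻¹`
case).  Binders `hreg` ((3.35)-shape class) and `hNE3` (node NE3, OPEN, BY NAME — now at rate `θ`) DISPLAYED; nothing about Bałaban's minimisers is
asserted. [folklore] -/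
theorem perturbationLaws_covariantLaplacian_of_regular_rate (hd : 1 ≤ d) (hreg : RegularTransporters L M R α β) {C : ℝ} (hC : 0 ≤ C)
    (hθ : ((L : ℝ)⁻¹) ≤ θ) (hNE3 : LocalRate (bgReadings L M (regClass L M R)) C θ) :
    PerturbationLaws (fun k => calDalev L M a ha k ⊗ₖ (1 : Matrix o o ℂ)) (covPertC L M R)
      (fun k => JpcT L M k ⊗ₖ (1 : Matrix o o ℂ)) (kappaCol o d a α (max β (betaNE3 o C)) (d * (α ^ 2 + 2 * β)))
      (fun k => C2col o d L a α (max β (betaNE3 o C)) (d * (2 * α * (betaNE3 o C + β) + 2 * betaNE3 o C)) * θ ^ k) := by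
  obtain ⟨hV, hz⟩ := matrixBoundsRate_of_regular_of_localRate hreg hC hθ hNE3
  exact perturbationLaws_colourCovariantLaplacian_rate L M a ha hd hθ (fun p => lipschitzBackgroundRate_entry L M hV p)
    (fun p => boundedBackgroundRate_entry L M hz p)

/-- **THE η-RATE OF THE COVARIANT-LAPLACIAN COUPLING IN THE REGULARITY CLASS, CONDITIONAL ON NE3 AT RATE `θ`** (`d ≥ 1`, `L⁻¹ ≤ θ < 1` — which
implies the twin's `2 ≤ L`, so that binder is dropped —, physical coupling `t = 1`, small-field regime `κ < 1` DISPLAYED): the lifted King-averaged unit-lattice covariances of `(Δ_a^{(k)} ⊗ 1 + Δ^{R_k} − Δ^1 ⊗ 1)⁻¹`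
converge as `k → ∞` with rate `θ^k` — `RegularBackgroundTower.covariantLaplacian_rate_of_regular` with node NE3's input allowed at ANY geometric rate,
through the owner's general-rate engine `NE2ColourPerturbedLayerRate.towerLimitRate_perturbed_king_kron_rate`.  One summand of three, model level,
conditional on NE3 (OPEN); NE2 NOT proved by this. [folklore] -/
theorem covariantLaplacian_rate_of_regular_rate (hd : 1 ≤ d) (hreg : RegularTransporters L M R α β) {C : ℝ} (hC : 0 ≤ C)
    (hθ : ((L : ℝ)⁻¹) ≤ θ) (hθ1 : θ < 1) (hNE3 : LocalRate (bgReadings L M (regClass L M R)) C θ)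
    (hsmall : kappaCol o d a α (max β (betaNE3 o C)) (d * (α ^ 2 + 2 * β)) < 1) :
    TowerLimitRate (fun k => Qlev L M k ⊗ₖ (1 : Matrix o o ℂ)) ((L : ℝ) ^ d)
      (fun k => (calDalev L M a ha k ⊗ₖ (1 : Matrix o o ℂ) + covPertC L M R k)⁻¹)
      (Cpert (kappaCol o d a α (max β (betaNE3 o C)) (d * (α ^ 2 + 2 * β))) (2 * d * Cst d a) (CJ d a)
        (C2col o d L a α (max β (betaNE3 o C)) (d * (2 * α * (betaNE3 o C + β) + 2 * betaNE3 o C))) 0 1) θ := by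
  have h := towerLimitRate_perturbed_king_kron_rate L M a ha hθ hθ1
    (perturbationLaws_covariantLaplacian_of_regular_rate L M a ha hd hreg hC hθ hNE3) (t := 1) (by rwa [norm_one, one_mul])
  simpa only [one_smul] using h

end TierB

end Summit.QuantumFields.BalabanUV.T4Continuum.CovariantLaplacianRate

end
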